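import Summits.Ventures.HSemireg.WedgeHankelRecurrenceGaussLegendreResultant
import Literature.Algebra.Polynomial.ChebyshevExplicitForms

/-!
# Venture HSemireg — **THE MIXED PRODUCT FORMULA `2 T_m U_k = U_{k+m} + U_{k−m}` AND THE NESTING `U_{k(n+1)−1} = U_{k−1}(T_{n+1}) · U_n`** (Mathlib's Chebyshev polynomials, any commutative ring):
# hence **`U_n ∣ U_{k(n+1)−1}`** — the zeros of `U_n` (second-kind Gauss–Chebyshev ∕ Fejér nodes `cos(jπ∕(n+1))`) are zeros of every `U_{k(n+1)−1}` (nested rules `n ↦ 2n+1 ↦ 4n+3 …`),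
# `U_{2n+1} = 2 T_{n+1} U_n`, `T_{2n+1} = 2 T_{n+1} T_n − X`

HONEST FRAMING. Part of the Lean index of the computation cell `pub-hsemireg` (seat p10 gen 47, Sunday typer «UNIFORM-IN-n»).  Polynomial algebra only (Mathlib `Polynomial.Chebyshev`); no variety,
no cohomology theory, no sheaf, no Ext group and no semiregularity map is constructed here; nothing here says that HC / HC_CM / HC_AV holds; no Literature fact (unproved `Prop`) is declared or
used.  Custodian versions as in `WedgeHankelSiegelIdeal` (1/3).
SOURCES (cited).  J. C. Mason, D. C. Handscomb, *Chebyshev Polynomials* (2003), §1.2.1–§1.2.2 (product formulae; `U_{mn−1} = U_{m−1}(T_n) U_{n−1}`), Ch. 8 (nested Fejér ∕ Clenshaw–Curtis node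
sets); T. J. Rivlin, *Chebyshev Polynomials* (1990), §1.2.  The identities are typed here from Mathlib's recurrences (`T_mul_T` is Mathlib's; the mixed formula is new here).
PROOF TYPED HERE.  `Polynomial.Chebyshev.induct` on `m` exactly as Mathlib's `T_mul_T`; the nesting from `Literature…U_mul_sub_one_eq_comp_mul`; `comp` bookkeeping (`sub_comp`, `mul_comp`, `X_comp`,
`ofNat_comp`).
DEDUP DISCLOSURE (`rg -n -i 'T_mul_U|U_comp_T|dvd_U_mul|U_mul_sub_one' Summits Literature` and Mathlib `Chebyshev.lean`, 2026-09-04): Mathlib has `T_mul_T`, `T_mul`;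
`Literature.Algebra.Polynomial.ChebyshevExplicitForms` HAS the nesting identity as `U_mul_sub_one_eq_comp_mul` (`U_{nm−1} = U_{m−1}(T_n) U_{n−1}`, Rivlin Ex. 1.2.15(e)) — imported and used
(the version below is its index shift `n ↦ n+1`), and a different addition formula `U_add_eq_U_mul_T_add_T_mul_U`; the `T`–`U` product formula and the corollaries are not there; 0 hits for the
6 names below.

WHAT IS IN THE TREE.  `Literature…ChebyshevExplicitForms.U_mul_sub_one_eq_comp_mul`; Mathlib `T_mul_T`, `T_mul`, `U_add_one`, `U_sub_one`, `U_add_two`, `U_sub_two`, `T_add_two`, `T_sub_one`, `U_neg_one`; N433 (`T`-composition against `T_n`).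
THIS FILE (namespace `Summit.Ventures.HSemireg.Wedge.HankelOuter` continued; CHAINED on N437; 0 definitions):
* §1203 **`chebyshevT_mul_U`** (`2 T_m U_k = U_{k+m} + U_{k−m}`, `m, k ∈ ℤ`), `chebyshevU_two_mul_add_one` (`U_{2n+1} = 2T_{n+1}U_n`), `chebyshevT_two_mul_add_one` (`T_{2n+1} = 2T_{n+1}T_n − X`),
  **`chebyshevU_mul_pred_eq_comp`** (`U_{k(n+1)−1} = U_{k−1}(T_{n+1}) U_n`), **`chebyshevU_dvd_U_mul_pred`**, `chebyshevU_eval_eq_zero_of_eval_eq_zero` (nested nodes).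
CAVEATS.  `k ∈ ℕ` in the nesting statements.  Nothing Ext-side.  New names only.
-/

open Module Polynomial
open scoped Matrix Polynomial

namespace Summit.Ventures.HSemireg.Wedge.HankelOuter

/-! ## §1203. `T`–`U` product formula and nesting of the second-kind nodes -/

/-- **`2 T_m U_k = U_{k+m} + U_{k−m}`** for all integers `m`, `k` (any commutative ring). [Mason–Handscomb §1.2.1; this file, §1203] -/
theorem chebyshevT_mul_U {R : Type*} [CommRing R] (m k : ℤ) :
    2 * Polynomial.Chebyshev.T R m * Polynomial.Chebyshev.U R k = Polynomial.Chebyshev.U R (k + m) + Polynomial.Chebyshev.U R (k - m) := by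
  induction m using Polynomial.Chebyshev.induct with
  | zero => simp [two_mul]
  | one => rw [Polynomial.Chebyshev.T_one, Polynomial.Chebyshev.U_add_one]; ring
  | add_two m ih1 ih2 =>
    have h₁ := Polynomial.Chebyshev.U_add_two R (k + m)
    have h₂ := Polynomial.Chebyshev.U_sub_two R (k - m)
    have h₃ := Polynomial.Chebyshev.T_add_two R m
    linear_combination (norm := ring_nf) 2 * Polynomial.Chebyshev.U R k * h₃ - h₁ - h₂ - ih2 + 2 * (X : R[X]) * ih1
  | neg_add_one m ih1 ih2 =>
    have h₁ := Polynomial.Chebyshev.U_sub_one R (k - m)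
    have h₂ := Polynomial.Chebyshev.U_add_one R (k + m)
    have h₃ := Polynomial.Chebyshev.T_sub_one R (-m)
    linear_combination (norm := ring_nf) 2 * Polynomial.Chebyshev.U R k * h₃ - h₁ - h₂ - ih2 + 2 * (X : R[X]) * ih1

/-- **`U_{2n+1} = 2 T_{n+1} U_n`.** [Mason–Handscomb §1.2.2; this file, §1203] -/
theorem chebyshevU_two_mul_add_one {R : Type*} [CommRing R] (n : ℤ) :
    Polynomial.Chebyshev.U R (2 * n + 1) = 2 * Polynomial.Chebyshev.T R (n + 1) * Polynomial.Chebyshev.U R n := by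
  have h := chebyshevT_mul_U (R := R) (n + 1) n
  rw [show n - (n + 1) = -1 by ring, Polynomial.Chebyshev.U_neg_one, add_zero, show n + (n + 1) = 2 * n + 1 by ring] at h
  exact h.symm

/-- **`T_{2n+1} = 2 T_{n+1} T_n − X`.** [Mason–Handscomb §1.2.1 (from Mathlib `T_mul_T`); this file, §1203] -/
theorem chebyshevT_two_mul_add_one {R : Type*} [CommRing R] (n : ℤ) :
    Polynomial.Chebyshev.T R (2 * n + 1) = 2 * Polynomial.Chebyshev.T R (n + 1) * Polynomial.Chebyshev.T R n - Polynomial.X := by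
  have h := Polynomial.Chebyshev.T_mul_T R (n + 1) n
  rw [show n + 1 - n = 1 by ring, Polynomial.Chebyshev.T_one, show n + 1 + n = 2 * n + 1 by ring] at h
  linear_combination -h

/-- **NESTING: `U_{k(n+1)−1} = U_{k−1}(T_{n+1}) · U_n`** (`k ∈ ℕ`, `n ∈ ℤ`, any commutative ring) — the index-shifted form of the LANDED
`Literature.Algebra.Polynomial.ChebyshevExplicitForms.U_mul_sub_one_eq_comp_mul` (Rivlin Ex. 1.2.15(e)). [Mason–Handscomb §1.2.2; this file, §1203] -/
theorem chebyshevU_mul_pred_eq_comp {R : Type*} [CommRing R] (k : ℕ) (n : ℤ) :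
    Polynomial.Chebyshev.U R ((k : ℤ) * (n + 1) - 1) = (Polynomial.Chebyshev.U R ((k : ℤ) - 1)).comp (Polynomial.Chebyshev.T R (n + 1)) * Polynomial.Chebyshev.U R n := by
  have h := Literature.Algebra.Polynomial.ChebyshevExplicitForms.U_mul_sub_one_eq_comp_mul R (n + 1) k
  rw [add_sub_cancel_right, mul_comm] at h
  exact h

/-- **`U_n ∣ U_{k(n+1)−1}`** (`k ∈ ℕ`). [Mason–Handscomb §1.2.2; this file, §1203] -/
theorem chebyshevU_dvd_U_mul_pred {R : Type*} [CommRing R] (k : ℕ) (n : ℤ) :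
    Polynomial.Chebyshev.U R n ∣ Polynomial.Chebyshev.U R ((k : ℤ) * (n + 1) - 1) :=
  ⟨(Polynomial.Chebyshev.U R ((k : ℤ) - 1)).comp (Polynomial.Chebyshev.T R (n + 1)), by rw [chebyshevU_mul_pred_eq_comp]; ring⟩

/-- **NESTED NODES: every zero of `U_n` is a zero of `U_{k(n+1)−1}`** (the second-kind Gauss–Chebyshev ∕ Fejér node sets are nested along `n ↦ k(n+1) − 1`). [Mason–Handscomb Ch. 8; this file,
§1203] -/
theorem chebyshevU_eval_eq_zero_of_eval_eq_zero {R : Type*} [CommRing R] (k : ℕ) (n : ℤ) {x : R} (hx : (Polynomial.Chebyshev.U R n).eval x = 0) :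
    (Polynomial.Chebyshev.U R ((k : ℤ) * (n + 1) - 1)).eval x = 0 := by
  rw [chebyshevU_mul_pred_eq_comp, eval_mul, hx, mul_zero]

end Summit.Ventures.HSemireg.Wedge.HankelOuter
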